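import Summits.ABC.ABC.Theses.RationalCuspPencil
import Literature.NumberTheory.DiophantineGeometry.MinimalDiscriminantProofs
import HarnessLib

/-!
# The six-torsion payoff: pencil engine + dictionary ⇒ Szpiro exponent `1/4` on the ℤ/6 class

`Summits/ABC/ABC/Theorems/RationalCuspPencilSixTorsionPayoff.lean` — closes the support item
stmt-ABC-24552 `Summit.ABC.ABC.Theses.RationalCuspPencil.SixTorsionPayoff`
(`PencilFourBound → SixTorsionDictionary → SixTorsionClassEpsShape`) of route `RationalCuspPencil`
(abc-idea-1 g4). Real-analysis glue only:

* `abs_disc_le`: `|u⁶ w² (u+w)³ (9u+w)| ≤ 80 · H¹²`, `H = max(|u|, |w|)`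
  (`|u+w| ≤ 2H`, `|9u+w| ≤ 10H`);
* `sixTorsionPayoff`: with the pencil engine at `(a₃, b₃, a₄, b₄) = (1, 1, 9, 1)` (constant `C₀`)
  and the dictionary (`|Δ_min| ≤ |u⁶w²(u+w)³(9u+w)|`, `rad(uw(u+w)(9u+w)) ∣ 6N`):
  `log|Δ_min| ≤ log 80 + 12 log H ≤ log 80 + 12 C₀⁺ (6N)^{1/4+ε} ≤ C · N^{1/4+ε}` with
  `C = log 80 + 12 · max(C₀, 0) · 6^{1/4+ε}` (`N ≥ 1`).

HONESTY. Glue; the class theorem it yields (`SixTorsionClassEpsShape`, Szpiro exponent `1/4` for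
every `E/ℚ` with a rational point of order six) is an ε-column / Szpiro-by-class RECORD — NOT abc,
NOT A-PS (polynomial Szpiro), NOT rung A1′; the route reaches `ABC` only through its DECLARED
RESIDUAL. [folklore] bookkeeping; sources of the two inputs: [StewartYu2001] Thm 2,
[SilvermanAEC2009] VII.1, VII.5.
-/

set_option linter.dupNamespace false

namespace Summit.ABC.ABC.Theorems

open UniqueFactorizationMonoid WeierstrassCurve
open Summit.ABC.ABC.Theses.RationalCuspPencil

namespace SixTorsionPayoff

/-- Height bound for the ℤ/6 discriminant form: `|u⁶ w² (u+w)³ (9u+w)| ≤ 80 · max(|u|,|w|)¹²`.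
[folklore] -/
theorem abs_disc_le (u w : ℤ) :
    |(((u ^ 6 * w ^ 2 * (u + w) ^ 3 * (9 * u + w) : ℤ)) : ℝ)| ≤
      80 * (((max |u| |w| : ℤ)) : ℝ) ^ 12 := by
  set H : ℝ := ((max |u| |w| : ℤ) : ℝ) with hH
  have hHeq : H = max |(u : ℝ)| |(w : ℝ)| := by rw [hH]; push_cast; rfl
  have hu : |(u : ℝ)| ≤ H := hHeq ▸ le_max_left _ _
  have hw : |(w : ℝ)| ≤ H := hHeq ▸ le_max_right _ _
  have hH0 : 0 ≤ H := (abs_nonneg _).trans hu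
  have h1 : |((u : ℝ) + w)| ≤ 2 * H := (abs_add_le _ _).trans (by linarith)
  have h2 : |(9 * (u : ℝ) + w)| ≤ 10 * H := by
    calc |(9 * (u : ℝ) + w)| ≤ |9 * (u : ℝ)| + |(w : ℝ)| := abs_add_le _ _
      _ = 9 * |(u : ℝ)| + |(w : ℝ)| := by rw [abs_mul]; norm_num
      _ ≤ 10 * H := by linarith
  push_cast
  rw [abs_mul, abs_mul, abs_mul, abs_pow, abs_pow, abs_pow]
  calc |(u : ℝ)| ^ 6 * |(w : ℝ)| ^ 2 * |(u : ℝ) + w| ^ 3 * |9 * (u : ℝ) + w|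
      ≤ H ^ 6 * H ^ 2 * (2 * H) ^ 3 * (10 * H) := by gcongr
    _ = 80 * H ^ 12 := by ring

/-- **The payoff** (unfolded): the pencil engine `PencilFourBound` and the dictionary
`SixTorsionDictionary` give the class theorem `SixTorsionClassEpsShape`, with
`C = log 80 + 12 · max(C₀, 0) · 6^{1/4+ε}` from the engine's constant `C₀` at
`(a₃, b₃, a₄, b₄) = (1, 1, 9, 1)`. [folklore] -/
theorem sixTorsionPayoff (hP : PencilFourBound) (hD : SixTorsionDictionary) :
    SixTorsionClassEpsShape := by
  unfold SixTorsionClassEpsShape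
  unfold PencilFourBound at hP
  unfold SixTorsionDictionary at hD
  intro ε hε
  obtain ⟨C₀, hC₀⟩ :=
    hP 1 1 9 1 one_ne_zero one_ne_zero (by norm_num) one_ne_zero (by norm_num) ε hε
  set e : ℝ := 1 / 4 + ε with he
  have he0 : 0 < e := by positivity
  refine ⟨Real.log 80 + 12 * max C₀ 0 * (6 : ℝ) ^ e, ?_⟩
  intro u w huw h0 W _ hW
  obtain ⟨hΔ, hrad⟩ := hD u w huw h0 W hW
  have h0' : u * w * (1 * u + 1 * w) * (9 * u + 1 * w) ≠ 0 := by simpa only [one_mul] using h0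
  have hlogH := hC₀ u w huw h0'
  simp only [one_mul] at hlogH
  -- positivity of the invariants
  have hΔpos : 0 < (W.minimalDiscriminantNorm ℤ : ℝ) := by
    exact_mod_cast minimalDiscriminantNorm_pos_holds W
  have hNposℕ : 0 < W.conductorNorm ℤ := conductorNorm_pos_holds W
  have hNpos : 0 < (W.conductorNorm ℤ : ℝ) := by exact_mod_cast hNposℕ
  have hN1 : 1 ≤ (W.conductorNorm ℤ : ℝ) := by exact_mod_cast hNposℕ
  -- the height `H = max(|u|, |w|) ≥ 1`
  have hH1 : (1 : ℝ) ≤ ((max |u| |w| : ℤ) : ℝ) := by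
    have h1 : (1 : ℤ) ≤ max |u| |w| := by
      rcases huw.ne_zero_or_ne_zero with hu | hw
      · exact le_max_of_le_left (Int.one_le_abs hu)
      · exact le_max_of_le_right (Int.one_le_abs hw)
    exact_mod_cast h1
  have hH0 : (0 : ℝ) < ((max |u| |w| : ℤ) : ℝ) := by linarith
  -- `rad ≤ 6 N`
  have hR : (((radical (u * w * (u + w) * (9 * u + w))).natAbs : ℕ) : ℝ) ≤
      6 * (W.conductorNorm ℤ : ℝ) := by
    have h1 := Nat.le_of_dvd (by positivity) hrad
    exact_mod_cast h1
  have hR0 : (0 : ℝ) ≤ (((radical (u * w * (u + w) * (9 * u + w))).natAbs : ℕ) : ℝ) :=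
    Nat.cast_nonneg _
  -- `log H ≤ C₀⁺ · 6^e · N^e`
  have hHe : Real.log ((max |u| |w| : ℤ) : ℝ) ≤
      max C₀ 0 * ((6 : ℝ) ^ e * (W.conductorNorm ℤ : ℝ) ^ e) := by
    calc Real.log ((max |u| |w| : ℤ) : ℝ)
        ≤ C₀ * (((radical (u * w * (u + w) * (9 * u + w))).natAbs : ℕ) : ℝ) ^ e := hlogH
      _ ≤ max C₀ 0 * (((radical (u * w * (u + w) * (9 * u + w))).natAbs : ℕ) : ℝ) ^ e :=
          mul_le_mul_of_nonneg_right (le_max_left _ _) (Real.rpow_nonneg hR0 _)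
      _ ≤ max C₀ 0 * (6 * (W.conductorNorm ℤ : ℝ)) ^ e :=
          mul_le_mul_of_nonneg_left (Real.rpow_le_rpow hR0 hR he0.le) (le_max_right _ _)
      _ = max C₀ 0 * ((6 : ℝ) ^ e * (W.conductorNorm ℤ : ℝ) ^ e) := by
          rw [Real.mul_rpow (by norm_num) hNpos.le]
  -- `log Δ_min ≤ log 80 + 12 log H`
  have hdisc_pos : 0 < |(((u ^ 6 * w ^ 2 * (u + w) ^ 3 * (9 * u + w) : ℤ)) : ℝ)| :=
    lt_of_lt_of_le hΔpos hΔ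
  have hlogΔ : Real.log (W.minimalDiscriminantNorm ℤ : ℝ) ≤
      Real.log 80 + 12 * Real.log ((max |u| |w| : ℤ) : ℝ) := by
    calc Real.log (W.minimalDiscriminantNorm ℤ : ℝ)
        ≤ Real.log |(((u ^ 6 * w ^ 2 * (u + w) ^ 3 * (9 * u + w) : ℤ)) : ℝ)| :=
          Real.log_le_log hΔpos hΔ
      _ ≤ Real.log (80 * ((max |u| |w| : ℤ) : ℝ) ^ 12) :=
          Real.log_le_log hdisc_pos (abs_disc_le u w)
      _ = Real.log 80 + 12 * Real.log ((max |u| |w| : ℤ) : ℝ) := by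
          rw [Real.log_mul (by norm_num) (by positivity), Real.log_pow]; push_cast; ring
  -- assemble
  have hNe1 : 1 ≤ (W.conductorNorm ℤ : ℝ) ^ e := Real.one_le_rpow hN1 he0.le
  have hlog80 : 0 ≤ Real.log 80 := Real.log_nonneg (by norm_num)
  calc Real.log (W.minimalDiscriminantNorm ℤ : ℝ)
      ≤ Real.log 80 + 12 * Real.log ((max |u| |w| : ℤ) : ℝ) := hlogΔ
    _ ≤ Real.log 80 * (W.conductorNorm ℤ : ℝ) ^ e +
          12 * (max C₀ 0 * ((6 : ℝ) ^ e * (W.conductorNorm ℤ : ℝ) ^ e)) :=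
        add_le_add (le_mul_of_one_le_right hlog80 hNe1) (by linarith [hHe])
    _ = (Real.log 80 + 12 * max C₀ 0 * (6 : ℝ) ^ e) * (W.conductorNorm ℤ : ℝ) ^ e := by ring

end SixTorsionPayoff

/-- **Closes stmt-ABC-24552 `SixTorsionPayoff` of route `RationalCuspPencil`**:
`PencilFourBound → SixTorsionDictionary → SixTorsionClassEpsShape` (real-analysis glue:
`|Δ| ≤ 80 H¹²`, `rad ∣ 6N`, `C = log 80 + 12 max(C₀,0) 6^{1/4+ε}`). Glue only; NOT abc, NOT A-PS,
moves no rung. [folklore] -/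
theorem sixTorsionPayoff_proof : Summit.ABC.ABC.Theses.RationalCuspPencil.SixTorsionPayoff := by
  unfold Summit.ABC.ABC.Theses.RationalCuspPencil.SixTorsionPayoff
  exact SixTorsionPayoff.sixTorsionPayoff

end Summit.ABC.ABC.Theorems
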